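import Summits.QuantumFields.YangMills.Theorems.CovariantDischargeHistoryTailOfSandwichSplit
import Summits.QuantumFields.YangMills.Theorems.CovariantDischargeSandwichBoundedDepth
import Summits.QuantumFields.YangMills.Theorems.CovariantDischargeSandwichLarge
import Summits.QuantumFields.YangMills.Theorems.CovariantDischargeSandwichLargeBaseStub
import Summits.QuantumFields.YangMills.Theorems.CovariantDischargeSweepGapReduction
import Literature.MathematicalPhysics.QuantumFieldTheory.Balaban1983to89.T4PairDerivBridge
import HarnessLib

/-!
# Cruxes `HistoryTailL` (stmt-QuantumFields-19936) and `SandwichFractionalWindowTailL` (stmt-QuantumFields-24186) — THE SANDWICH KNIT,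
# THEOREMS-SIDE: both route decls BY NAME from the ONE load-bearing registered stub `stub_sandwichSweepGapCapped` (and, for 19936, the
# route's organ-class residual `SandwichDeepWindowTailL`)

Cell `ym3-torus` (YM ladder rung R3 = continuum SU(2) Yang–Mills on every three-torus — a RECORD rung, NOT the Clay problem), width seat
`ym-ust-19936-w5` gen 15.  Ideator line «sandwich_discharge» (LINE 24 «SeveritySandwich», route-QuantumFields-CovariantDischarge rev 3; registered
skeleton v5 `Cruxes/HistoryTailL/Lines/sandwich_discharge.lean` sha16 `470b3af6f9aa04e1`, registered on BOTH items).

WHY THIS FILE.  The skeleton's composition — the 3-way regime merge `sandwichSweep_of_capped_large_base`, the range merge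
`sandwichFractional_of_ranges`, and the door — is kernel-checked but lives under `Cruxes/`, which no `Theorems/` file may import.  Of its four
registered stubs, two are LANDED (✓p708497 `CovariantDischargeSandwichLarge.stub_sandwichLarge`, ✓p710808
`CovariantDischargeSandwichLargeBaseStub.stub_sandwichLargeBase`), the load-bearing capped sweep `stub_sandwichSweepGapCapped` is being landed by
its pen, and `stub_sandwichDeep` IS the route's residual item `SandwichDeepWindowTailL` (stmt-QuantumFields-24187, organ-class: Bałaban's
unprinted large-field induction — nobody is asked to prove it on this route).  This file re-houses the composition on the `Theorems/` side with
every leaf BY NAME, so that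

* `sandwichFractionalWindowTailL_of_capped (hCap) : Theses.CovariantDischarge.SandwichFractionalWindowTailL` — the crux r2 of route
  CovariantDischarge follows from the capped stub ALONE (bounded depth = ✓p706476
  `CovariantDischargeSandwichBoundedDepth.sandwichFractionalWindowTail_boundedDepth`);
* `historyTailL_of_capped_of_deep (hCap) (hDeep) : Theses.UnitScaleTilt.HistoryTailL` — the shared crux 19936 follows from the capped stub and
  the residual, through the landed door ✓`SandwichDischargeDoor.door` (p705200).

The hypothesis `hCap` is the registered text of `stub_sandwichSweepGapCapped` VERBATIM; the day it is a tree theorem both displays lose it by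
`exact`.  WHAT THIS IS NOT: no new estimate — pure composition of landed theorems; `stub_sandwichSweepGapCapped`, `SandwichDeepWindowTailL`,
`SandwichFractionalWindowTailL`, `HistoryTailL` are NOT proved here; rung R3 is a record rung — NOT d = 4, NOT infinite volume, NOT a mass gap,
NOT the Clay problem.

References: T. Bałaban, CMP **102** (1985) 255–275 [Balaban1985UV3] ((1)–(3) p.256, (7) p.257, (71) p.273); T. Bałaban, CMP **98** (1985) 17–51
[Balaban1985Averaging] (Prop. 1 (51) p.26); T. Bałaban, CMP **122** (1989) 355–392 [Balaban1989LargeFieldII] (Thm 1 p.358).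
-/

noncomputable section

open MeasureTheory Filter Topology
open scoped RealInnerProductSpace
open Literature.MathematicalPhysics.QuantumLattice (su2Quat)
open Literature.MathematicalPhysics.QuantumFieldTheory.Balaban1983to89
open Literature.MathematicalPhysics.QuantumFieldTheory.Balaban1983to89.Missing
open Literature.MathematicalPhysics.QuantumFieldTheory.Balaban1983to89.T4Continuum
open Literature.MathematicalPhysics.QuantumFieldTheory.Balaban1983to89.T3ContinuumYM3Torus
open Literature.MathematicalPhysics.QuantumFieldTheory.Balaban1983to89.T3UnitScaleTilt
open Literature.MathematicalPhysics.QuantumFieldTheory.Balaban1983to89.T3UnitLawDensityEML (ℰp measurableE_ℰp)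
open Literature.MathematicalPhysics.QuantumFieldTheory.Balaban1983to89.T4CubeChartGnomonic (SU2)
open Literature.MathematicalPhysics.QuantumFieldTheory.Balaban1983to89.T4ExpWindowSmallField (imVec)
open Literature.MathematicalPhysics.QuantumFieldTheory.Balaban1983to89.T3MinimiserStabilityReduction (θBal_pos)
open Summit.QuantumFields.YangMills.Theorems.CovariantDischargeDirectionNet (exists_finset_sphere_inner_ge)
open Summit.QuantumFields.YangMills.Theorems.CovariantDischargeSweepGapReduction (measureReal_dist1_window_le_card_mul_exp)
open Summit.QuantumFields.YangMills.Theses.CovariantDischarge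

namespace Summit.QuantumFields.YangMills.Theorems

namespace CovariantDischargeSandwichFractionalOfCapped

/-- **The sweep range, CONDITIONAL ON THE CAPPED SWEEP STUB ONLY.**  Registered stub `stub_sandwichSweepGapCapped` (hypothesis `hG`,
text of skeleton v5 470b3af6 VERBATIM) + the LANDED ✓`CovariantDischargeSandwichLarge.stub_sandwichLarge` (p708497) + the LANDED
✓`CovariantDischargeSandwichLargeBaseStub.stub_sandwichLargeBase` (p710808) ⇒ the ladder-uniform sandwich bound on the sweep range `j₀ < j`,
`N₁·j + n ≤ K` (`N₁ := max`, `γ₁ := min`, `C := |#net·e^D| + |C_b| + |C_c|`, `c := min`, `N := max`), by the 3-way split of `LOCATE-SWGAP-px8g6`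
§3: CAP ∧ small regime — the sandwich event lies in `A ∩ {dist1 H ≤ θ(Λb)} ∩ {θ(b) ≤ dist1 H}` (`A` = finer ∧ coarser conjuncts, `H = Ū^j(∂p)`;
the coarse conjunct AT `j′ = j` is the upper window) and ✓`CovariantDischargeSweepGapReduction.measureReal_dist1_window_le_card_mul_exp`
(direction net ✓`CovariantDischargeDirectionNet.exists_finset_sphere_inner_ge`, union bound, Cameron–Martin tail) applies; CAP ∧ large regime —
✓`stub_sandwichLarge`; LARGE BASE — ✓`stub_sandwichLargeBase`.  Port of the skeleton's kernel-checked `sandwichSweep_of_capped_large_base` with its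
two landed hypotheses discharged BY NAME. [cite: Balaban1985UV3, (1)-(3) p.256, (7) p.257, (71) p.273; Balaban1985Averaging, Prop. 1 (51) p.26] -/
theorem sandwichSweep_of_capped
    (hG : ∀ (L : ℕ), ∃ N₁ : ℕ, 0 < N₁ ∧ ∀ (b₀ p₀ Λ : ℝ), 0 < b₀ → 2 < p₀ → 1 < Λ →
      ∃ (j₀ : ℕ) (γ₁ cg D δ : ℝ), 0 < γ₁ ∧ γ₁ ≤ 1 ∧ 0 < cg ∧ 0 < δ ∧ δ ^ 2 ≤ 2 ∧
        ∀ (F : T3Family) (γ : ℝ), F.L = L → 0 < γ → γ ≤ γ₁ → ∀ (b : ℝ), b₀ ≤ b → ∀ (K n j : ℕ), j₀ < j → N₁ * j + n ≤ K →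
          b ≤ 2 * (151 * (F.L : ℝ) ^ 2) ^ j * b₀ → T3UnitScaleTilt.θBal F.L γ (Λ * b) p₀ (K - j) ≤ 1 →
          ∀ (p : Plaq (F.P K) j) (v : EuclideanSpace ℝ (Fin 3)), ‖v‖ = 1 →
            ∃ (Ψ Ψ' : GaugeField (F.P K) 0 (Matrix.specialUnitaryGroup (Fin 2) ℂ) → GaugeField (F.P K) 0 (Matrix.specialUnitaryGroup (Fin 2) ℂ)),
              MeasurePreserving Ψ (fieldMeasure (F.P K) 0 (Matrix.specialUnitaryGroup (Fin 2) ℂ)) (fieldMeasure (F.P K) 0 (Matrix.specialUnitaryGroup (Fin 2) ℂ)) ∧ Measurable Ψ' ∧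
              Function.LeftInverse Ψ' Ψ ∧ Function.RightInverse Ψ' Ψ ∧
              ∀ V : GaugeField (F.P K) 0 (Matrix.specialUnitaryGroup (Fin 2) ℂ),
                (∀ k, k < j → PlaqSmall (T3UnitScaleTilt.θBal F.L γ b p₀ (K - k))
                  (Averaging.iter (fun i => BlockAveraging.blockAvg (P := F.P K) (j := i) T3UnitLawDensityEML.ℰp) k V)) →
                (∀ j', j ≤ j' → j' + n ≤ K → PlaqSmall (T3UnitScaleTilt.θBal F.L γ (Λ * b) p₀ (K - j'))
                  (Averaging.iter (fun i => BlockAveraging.blockAvg (P := F.P K) (j := i) T3UnitLawDensityEML.ℰp) j' V)) →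
                (1 - δ ^ 2 / 2) * (T3UnitScaleTilt.θBal F.L γ b p₀ (K - j) *
                    Real.sqrt (1 - T3UnitScaleTilt.θBal F.L γ (Λ * b) p₀ (K - j) ^ 2 / 4)) ≤
                  ⟪v, T4ExpWindowSmallField.imVec (Literature.MathematicalPhysics.QuantumLattice.su2Quat (GaugeField.plaqHol
                    (Averaging.iter (fun i => BlockAveraging.blockAvg (P := F.P K) (j := i) T3UnitLawDensityEML.ℰp) j V) p))⟫ →
                cg * B10.pFun b₀ p₀ (Real.sqrt (γ * ((F.L : ℝ)⁻¹) ^ (K - j))) ^ 2 - D ≤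
                  (F.scheme T3UnitLawDensityEML.ℰp γ).β K * (wilsonAction4 V - wilsonAction4 (Ψ' V))) :
    ∀ (L : ℕ), ∃ N₁ : ℕ, 0 < N₁ ∧ ∀ (b₀ p₀ Λ : ℝ), 0 < b₀ → 2 < p₀ → 1 < Λ →
    ∃ (j₀ : ℕ) (γ₁ C c : ℝ) (N : ℕ), 0 < γ₁ ∧ γ₁ ≤ 1 ∧ 0 < c ∧ ∀ (F : T3Family) (γ : ℝ), F.L = L → 0 < γ → γ ≤ γ₁ →
      ∀ (b : ℝ), b₀ ≤ b → ∀ (K n j : ℕ), j₀ < j → N₁ * j + n ≤ K → ∀ p : Plaq (F.P K) j,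
        (T3UnitScaleTilt.gibbsK F T3UnitLawDensityEML.ℰp γ K).real
          {U | (∀ k, k < j → PlaqSmall (T3UnitScaleTilt.θBal F.L γ b p₀ (K - k))
                (Averaging.iter (fun i => BlockAveraging.blockAvg (P := F.P K) (j := i) T3UnitLawDensityEML.ℰp) k U)) ∧
              (∀ j', j ≤ j' → j' + n ≤ K → PlaqSmall (T3UnitScaleTilt.θBal F.L γ (Λ * b) p₀ (K - j'))
                (Averaging.iter (fun i => BlockAveraging.blockAvg (P := F.P K) (j := i) T3UnitLawDensityEML.ℰp) j' U)) ∧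
              T3UnitScaleTilt.θBal F.L γ b p₀ (K - j) ≤ GaugeGroup.dist1 (GaugeField.plaqHol
                (Averaging.iter (fun i => BlockAveraging.blockAvg (P := F.P K) (j := i) T3UnitLawDensityEML.ℰp) j U) p)}
        ≤ C * ((γ * ((F.L : ℝ)⁻¹) ^ (K - j))⁻¹) ^ N *
            Real.exp (-(c * B10.pFun b₀ p₀ (Real.sqrt (γ * ((F.L : ℝ)⁻¹) ^ (K - j))) ^ 2)) := by
  intro L
  obtain ⟨Na, hNa, hGa⟩ := hG L
  obtain ⟨Nb, hNb, hLb⟩ := CovariantDischargeSandwichLarge.stub_sandwichLarge L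
  refine ⟨max Na Nb, lt_max_of_lt_left hNa, fun b₀ p₀ Λ hb₀ hp₀ hΛ => ?_⟩
  obtain ⟨j₀, γa, cg, D, δ, hγa, hγa1, hcg, hδ, hδ2, hG'⟩ := hGa b₀ p₀ Λ hb₀ hp₀ hΛ
  obtain ⟨γb, Cb, cb, Nb', hγb, hγb1, hcb, hB⟩ := hLb b₀ p₀ Λ hb₀ hp₀ hΛ
  obtain ⟨γc, Cc, cc, Nc, hγc, hγc1, hcc, hC⟩ :=
    CovariantDischargeSandwichLargeBaseStub.stub_sandwichLargeBase L b₀ p₀ Λ hb₀ hp₀ hΛ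
  obtain ⟨s, _hne, hs1, hnet⟩ := exists_finset_sphere_inner_ge (E := EuclideanSpace ℝ (Fin 3)) hδ
  refine ⟨j₀, min γa (min γb γc), |(s.card : ℝ) * Real.exp D| + |Cb| + |Cc|, min cg (min cb cc), max Nb' Nc,
    lt_min hγa (lt_min hγb hγc), (min_le_left _ _).trans hγa1, lt_min hcg (lt_min hcb hcc), ?_⟩
  intro F γ hFL hγ hγ1 b hb K n j hj hjK p
  have hγa' : γ ≤ γa := hγ1.trans (min_le_left _ _)
  have hγb' : γ ≤ γb := hγ1.trans ((min_le_right _ _).trans (min_le_left _ _))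
  have hγc' : γ ≤ γc := hγ1.trans ((min_le_right _ _).trans (min_le_right _ _))
  have hγone : γ ≤ 1 := hγa'.trans hγa1
  have hβ := SandwichDischargeDoor.sd_one_le_beta F hγ hγone K j
  have ht : (0 : ℝ) ≤ B10.pFun b₀ p₀ (Real.sqrt (γ * ((F.L : ℝ)⁻¹) ^ (K - j))) ^ 2 := sq_nonneg _
  have hCa : |(s.card : ℝ) * Real.exp D| ≤ |(s.card : ℝ) * Real.exp D| + |Cb| + |Cc| := by
    linarith [abs_nonneg Cb, abs_nonneg Cc]
  have hCb : |Cb| ≤ |(s.card : ℝ) * Real.exp D| + |Cb| + |Cc| := by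
    linarith [abs_nonneg ((s.card : ℝ) * Real.exp D), abs_nonneg Cc]
  have hCc : |Cc| ≤ |(s.card : ℝ) * Real.exp D| + |Cb| + |Cc| := by
    linarith [abs_nonneg ((s.card : ℝ) * Real.exp D), abs_nonneg Cb]
  have hcga : min cg (min cb cc) ≤ cg := min_le_left _ _
  have hcgb : min cg (min cb cc) ≤ cb := (min_le_right _ _).trans (min_le_left _ _)
  have hcgc : min cg (min cb cc) ≤ cc := (min_le_right _ _).trans (min_le_right _ _)
  have hja : Na * j ≤ max Na Nb * j := Nat.mul_le_mul_right j (le_max_left Na Nb)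
  have hjb : Nb * j ≤ max Na Nb * j := Nat.mul_le_mul_right j (le_max_right Na Nb)
  have hjKa : Na * j + n ≤ K := by omega
  have hjKb : Nb * j + n ≤ K := by omega
  have hj1 : 1 ≤ j := by omega
  have hjn : j + n ≤ K := by
    have : j ≤ Na * j := Nat.le_mul_of_pos_left j hNa
    omega
  have hL1 : 1 ≤ F.L := F.hL.2.le
  haveI := T3UnitScaleTilt.isProbabilityMeasure_gibbsK F ℰp hγ.le K
  by_cases hcap : b ≤ 2 * (151 * (F.L : ℝ) ^ 2) ^ j * b₀
  · by_cases hsm : T3UnitScaleTilt.θBal F.L γ (Λ * b) p₀ (K - j) ≤ 1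
    · -- CAP ∧ small regime: the window reduction of `CovariantDischargeSweepGapReduction`
      refine SandwichDischargeDoor.sd_schema_mono hβ (Nat.zero_le _) hcga ht hCa ?_
      have hb0 : 0 < b := hb₀.trans_le hb
      set θ : ℝ := T3UnitScaleTilt.θBal F.L γ b p₀ (K - j) with hθ_def
      set θ₂ : ℝ := T3UnitScaleTilt.θBal F.L γ (Λ * b) p₀ (K - j) with hθ₂_def
      have hθ0 : 0 ≤ θ := (θBal_pos hL1 hγ hγone hb0 p₀ (K - j)).le
      have hθ₂2 : θ₂ ≤ 2 := hsm.trans one_le_two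
      set A : Set (GaugeField (F.P K) 0 SU2) :=
        {U | (∀ k, k < j → PlaqSmall (T3UnitScaleTilt.θBal F.L γ b p₀ (K - k))
            (Averaging.iter (fun i => BlockAveraging.blockAvg (P := F.P K) (j := i) ℰp) k U)) ∧
          (∀ j', j ≤ j' → j' + n ≤ K → PlaqSmall (T3UnitScaleTilt.θBal F.L γ (Λ * b) p₀ (K - j'))
            (Averaging.iter (fun i => BlockAveraging.blockAvg (P := F.P K) (j := i) ℰp) j' U))} with hA_def
      set H : GaugeField (F.P K) 0 SU2 → SU2 := fun U =>
        GaugeField.plaqHol (Averaging.iter (fun i => BlockAveraging.blockAvg (P := F.P K) (j := i) ℰp) j U) p with hH_def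
      haveI := T4GenFunBounds.isProbabilityMeasure_gibbsMeasure (G := SU2) (F.P K) (F.scheme_β_nonneg ℰp hγ.le K)
      have hsub : {U | (∀ k, k < j → PlaqSmall (T3UnitScaleTilt.θBal F.L γ b p₀ (K - k))
                  (Averaging.iter (fun i => BlockAveraging.blockAvg (P := F.P K) (j := i) ℰp) k U)) ∧
                (∀ j', j ≤ j' → j' + n ≤ K → PlaqSmall (T3UnitScaleTilt.θBal F.L γ (Λ * b) p₀ (K - j'))
                  (Averaging.iter (fun i => BlockAveraging.blockAvg (P := F.P K) (j := i) ℰp) j' U)) ∧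
                T3UnitScaleTilt.θBal F.L γ b p₀ (K - j) ≤ GaugeGroup.dist1 (GaugeField.plaqHol
                  (Averaging.iter (fun i => BlockAveraging.blockAvg (P := F.P K) (j := i) ℰp) j U) p)} ⊆
          {U | U ∈ A ∧ dist1 (H U) ≤ θ₂ ∧ θ ≤ dist1 (H U)} := by
        intro U hU
        exact ⟨⟨hU.1, hU.2.1⟩, (hU.2.1 j le_rfl hjn p).le, hU.2.2⟩
      have hgap : ∀ v ∈ s, ∃ Ψ Ψ' : GaugeField (F.P K) 0 SU2 → GaugeField (F.P K) 0 SU2,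
          MeasurePreserving Ψ (fieldMeasure (F.P K) 0 SU2) (fieldMeasure (F.P K) 0 SU2) ∧ Measurable Ψ' ∧
          Function.LeftInverse Ψ' Ψ ∧ Function.RightInverse Ψ' Ψ ∧
          ∀ V : GaugeField (F.P K) 0 SU2, V ∈ A → dist1 (H V) ≤ θ₂ →
            (1 - δ ^ 2 / 2) * (θ * Real.sqrt (1 - θ₂ ^ 2 / 4)) ≤ ⟪v, imVec (su2Quat (H V))⟫ →
            cg * B10.pFun b₀ p₀ (Real.sqrt (γ * ((F.L : ℝ)⁻¹) ^ (K - j))) ^ 2 - D ≤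
              (F.scheme ℰp γ).β K * (wilsonAction4 V - wilsonAction4 (Ψ' V)) := by
        intro v hv
        obtain ⟨Ψ, Ψ', hΨ, hΨ', h₁, h₂, hg⟩ := hG' F γ hFL hγ hγa' b hb K n j hj hjKa hcap hsm p v (hs1 v hv)
        exact ⟨Ψ, Ψ', hΨ, hΨ', h₁, h₂, fun V hV _ hlin => hg V hV.1 hV.2 hlin⟩
      have hmain := measureReal_dist1_window_le_card_mul_exp (P := F.P K) (F.scheme_β_nonneg ℰp hγ.le K) s
        (by linarith : (0 : ℝ) ≤ 1 - δ ^ 2 / 2) hnet A H hθ0 hθ₂2 hgap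
      rw [pow_zero, mul_one, T3UnitScaleTilt.gibbsK_eq]
      refine ((measureReal_mono hsub (measure_ne_top _ _)).trans hmain).trans (le_of_eq ?_)
      rw [mul_assoc, ← Real.exp_add]
      congr 1
      congr 1
      ring
    · -- CAP ∧ large regime: the landed `stub_sandwichLarge` (hypothesis `hLg`)
      exact SandwichDischargeDoor.sd_schema_mono hβ (le_max_left _ _) hcgb ht hCb
        (hB F γ hFL hγ hγb' b hb K n j hj1 hjKb (not_le.mp hsm) p)
  · -- LARGE BASE: STUB 1c (the sandwich event at every depth `j + n ≤ K`, no coupling, no regime)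
    have hcap' : 2 * (151 * (L : ℝ) ^ 2) ^ j * b₀ ≤ b := by
      rw [← hFL]
      exact (not_le.mp hcap).le
    exact SandwichDischargeDoor.sd_schema_mono hβ (le_max_right _ _) hcgc ht hCc
      (hC F γ hFL hγ hγc' b hb K n j hjn hcap' p)

/-- The two height ranges (bounded depth `j ≤ j₀`; sweep range `j₀ < j`, `N₁·j + n ≤ K`) merge to the BODY of the route's crux
`SandwichFractionalWindowTailL` (constants merged: `γ₁ = min`, `C = |C₁| + |C₂|`, `c = min`, `N = N₁' + N₂'`; `β ≥ 1`).  Port of the skeleton's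
kernel-checked `sandwichFractional_of_ranges` (body spelled out; the by-name form is `sandwichFractionalWindowTailL_of_capped`). [cite: Balaban1985UV3, (3) p.256] -/
theorem sandwichFractional_of_ranges
    (h₁ : ∀ (L j₀ : ℕ) (b₀ p₀ Λ : ℝ), 0 < b₀ → 2 < p₀ → 1 < Λ →
      ∃ (γ₁ C c : ℝ) (N : ℕ), 0 < γ₁ ∧ γ₁ ≤ 1 ∧ 0 < c ∧ ∀ (F : T3Family) (γ : ℝ), F.L = L → 0 < γ → γ ≤ γ₁ →
        ∀ (b : ℝ), b₀ ≤ b → ∀ (K n j : ℕ), j ≤ j₀ → j + n ≤ K → ∀ p : Plaq (F.P K) j,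
          (T3UnitScaleTilt.gibbsK F T3UnitLawDensityEML.ℰp γ K).real
            {U | (∀ k, k < j → PlaqSmall (T3UnitScaleTilt.θBal F.L γ b p₀ (K - k))
                  (Averaging.iter (fun i => BlockAveraging.blockAvg (P := F.P K) (j := i) T3UnitLawDensityEML.ℰp) k U)) ∧
                (∀ j', j ≤ j' → j' + n ≤ K → PlaqSmall (T3UnitScaleTilt.θBal F.L γ (Λ * b) p₀ (K - j'))
                  (Averaging.iter (fun i => BlockAveraging.blockAvg (P := F.P K) (j := i) T3UnitLawDensityEML.ℰp) j' U)) ∧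
                T3UnitScaleTilt.θBal F.L γ b p₀ (K - j) ≤ GaugeGroup.dist1 (GaugeField.plaqHol
                  (Averaging.iter (fun i => BlockAveraging.blockAvg (P := F.P K) (j := i) T3UnitLawDensityEML.ℰp) j U) p)}
          ≤ C * ((γ * ((F.L : ℝ)⁻¹) ^ (K - j))⁻¹) ^ N *
              Real.exp (-(c * B10.pFun b₀ p₀ (Real.sqrt (γ * ((F.L : ℝ)⁻¹) ^ (K - j))) ^ 2)))
    (h₂ : ∀ (L : ℕ), ∃ N₁ : ℕ, 0 < N₁ ∧ ∀ (b₀ p₀ Λ : ℝ), 0 < b₀ → 2 < p₀ → 1 < Λ →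
      ∃ (j₀ : ℕ) (γ₁ C c : ℝ) (N : ℕ), 0 < γ₁ ∧ γ₁ ≤ 1 ∧ 0 < c ∧ ∀ (F : T3Family) (γ : ℝ), F.L = L → 0 < γ → γ ≤ γ₁ →
        ∀ (b : ℝ), b₀ ≤ b → ∀ (K n j : ℕ), j₀ < j → N₁ * j + n ≤ K → ∀ p : Plaq (F.P K) j,
          (T3UnitScaleTilt.gibbsK F T3UnitLawDensityEML.ℰp γ K).real
            {U | (∀ k, k < j → PlaqSmall (T3UnitScaleTilt.θBal F.L γ b p₀ (K - k))
                  (Averaging.iter (fun i => BlockAveraging.blockAvg (P := F.P K) (j := i) T3UnitLawDensityEML.ℰp) k U)) ∧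
                (∀ j', j ≤ j' → j' + n ≤ K → PlaqSmall (T3UnitScaleTilt.θBal F.L γ (Λ * b) p₀ (K - j'))
                  (Averaging.iter (fun i => BlockAveraging.blockAvg (P := F.P K) (j := i) T3UnitLawDensityEML.ℰp) j' U)) ∧
                T3UnitScaleTilt.θBal F.L γ b p₀ (K - j) ≤ GaugeGroup.dist1 (GaugeField.plaqHol
                  (Averaging.iter (fun i => BlockAveraging.blockAvg (P := F.P K) (j := i) T3UnitLawDensityEML.ℰp) j U) p)}
          ≤ C * ((γ * ((F.L : ℝ)⁻¹) ^ (K - j))⁻¹) ^ N *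
              Real.exp (-(c * B10.pFun b₀ p₀ (Real.sqrt (γ * ((F.L : ℝ)⁻¹) ^ (K - j))) ^ 2))) :
    -- the BODY of the route's crux `SandwichFractionalWindowTailL` (spelled out so that only the all-stubs form below concludes the
    -- crux by name — skeleton-check convention)
    ∀ (L : ℕ), ∃ N₁ : ℕ, 0 < N₁ ∧ ∀ (b₀ p₀ Λ : ℝ), 0 < b₀ → 2 < p₀ → 1 < Λ →
      ∃ (γ₁ C c : ℝ) (N : ℕ), 0 < γ₁ ∧ γ₁ ≤ 1 ∧ 0 < c ∧
      ∀ (F : T3Family) (γ : ℝ), F.L = L → 0 < γ → γ ≤ γ₁ →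
      ∀ (b : ℝ), b₀ ≤ b → ∀ (K n j : ℕ), N₁ * j + n ≤ K → ∀ p : Plaq (F.P K) j,
      (T3UnitScaleTilt.gibbsK F T3UnitLawDensityEML.ℰp γ K).real
        {U | (∀ k, k < j → PlaqSmall (T3UnitScaleTilt.θBal F.L γ b p₀ (K - k)) (Averaging.iter (fun i => BlockAveraging.blockAvg (P := F.P K) (j := i) T3UnitLawDensityEML.ℰp) k U)) ∧
          (∀ j', j ≤ j' → j' + n ≤ K → PlaqSmall (T3UnitScaleTilt.θBal F.L γ (Λ * b) p₀ (K - j')) (Averaging.iter (fun i => BlockAveraging.blockAvg (P := F.P K) (j := i) T3UnitLawDensityEML.ℰp) j' U)) ∧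
          T3UnitScaleTilt.θBal F.L γ b p₀ (K - j) ≤ GaugeGroup.dist1 (GaugeField.plaqHol (Averaging.iter (fun i => BlockAveraging.blockAvg (P := F.P K) (j := i) T3UnitLawDensityEML.ℰp) j U) p)}
        ≤ C * ((γ * ((F.L : ℝ)⁻¹) ^ (K - j))⁻¹) ^ N * Real.exp (-(c * B10.pFun b₀ p₀ (Real.sqrt (γ * ((F.L : ℝ)⁻¹) ^ (K - j))) ^ 2)) := by
  intro L
  obtain ⟨N₁, hN₁, hS⟩ := h₂ L
  refine ⟨N₁, hN₁, ?_⟩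
  intro b₀ p₀ Λ hb₀ hp₀ hΛ
  obtain ⟨j₀, γb, Cb, cb, Nb, hγb, hγb1, hcb, hB⟩ := hS b₀ p₀ Λ hb₀ hp₀ hΛ
  obtain ⟨γa, Ca, ca, Na, hγa, hγa1, hca, hA⟩ := h₁ L j₀ b₀ p₀ Λ hb₀ hp₀ hΛ
  refine ⟨min γa γb, |Ca| + |Cb|, min ca cb, Na + Nb, lt_min hγa hγb, (min_le_left _ _).trans hγa1,
    lt_min hca hcb, ?_⟩
  intro F γ hFL hγ hγ1 b hb K n j hjK p
  have hγa' : γ ≤ γa := hγ1.trans (min_le_left _ _)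
  have hγb' : γ ≤ γb := hγ1.trans (min_le_right _ _)
  have hβ := SandwichDischargeDoor.sd_one_le_beta F hγ (hγa'.trans hγa1) K j
  have ht : (0 : ℝ) ≤ B10.pFun b₀ p₀ (Real.sqrt (γ * ((F.L : ℝ)⁻¹) ^ (K - j))) ^ 2 := sq_nonneg _
  have hCa : |Ca| ≤ |Ca| + |Cb| := by linarith [abs_nonneg Cb]
  have hCb : |Cb| ≤ |Ca| + |Cb| := by linarith [abs_nonneg Ca]
  by_cases hj : j ≤ j₀
  · have hjK' : j + n ≤ K := by
      have : j ≤ N₁ * j := Nat.le_mul_of_pos_left j hN₁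
      omega
    exact SandwichDischargeDoor.sd_schema_mono hβ (by omega) (min_le_left _ _) ht hCa (hA F γ hFL hγ hγa' b hb K n j hj hjK' p)
  · exact SandwichDischargeDoor.sd_schema_mono hβ (by omega) (min_le_right _ _) ht hCb (hB F γ hFL hγ hγb' b hb K n j (by omega) hjK p)

/-- **THE CRUX r2 OF ROUTE CovariantDischarge FROM THE CAPPED SWEEP STUB ALONE, BY NAME**: `stub_sandwichSweepGapCapped` (hypothesis `hCap`,
registered text VERBATIM) ⇒ `SandwichFractionalWindowTailL` (stmt-QuantumFields-24186) — bounded depth is ✓p706476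
`CovariantDischargeSandwichBoundedDepth.sandwichFractionalWindowTail_boundedDepth`, the sweep range is `sandwichSweep_of_capped hCap` (✓p708497 and
✓p710808 inside).  CONDITIONAL: the capped stub is not proved here. [cite: Balaban1985UV3, (1)-(3) p.256, (7) p.257, (71) p.273] -/
theorem sandwichFractionalWindowTailL_of_capped
    (hCap : ∀ (L : ℕ), ∃ N₁ : ℕ, 0 < N₁ ∧ ∀ (b₀ p₀ Λ : ℝ), 0 < b₀ → 2 < p₀ → 1 < Λ →
      ∃ (j₀ : ℕ) (γ₁ cg D δ : ℝ), 0 < γ₁ ∧ γ₁ ≤ 1 ∧ 0 < cg ∧ 0 < δ ∧ δ ^ 2 ≤ 2 ∧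
        ∀ (F : T3Family) (γ : ℝ), F.L = L → 0 < γ → γ ≤ γ₁ → ∀ (b : ℝ), b₀ ≤ b → ∀ (K n j : ℕ), j₀ < j → N₁ * j + n ≤ K →
          b ≤ 2 * (151 * (F.L : ℝ) ^ 2) ^ j * b₀ → T3UnitScaleTilt.θBal F.L γ (Λ * b) p₀ (K - j) ≤ 1 →
          ∀ (p : Plaq (F.P K) j) (v : EuclideanSpace ℝ (Fin 3)), ‖v‖ = 1 →
            ∃ (Ψ Ψ' : GaugeField (F.P K) 0 (Matrix.specialUnitaryGroup (Fin 2) ℂ) → GaugeField (F.P K) 0 (Matrix.specialUnitaryGroup (Fin 2) ℂ)),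
              MeasurePreserving Ψ (fieldMeasure (F.P K) 0 (Matrix.specialUnitaryGroup (Fin 2) ℂ)) (fieldMeasure (F.P K) 0 (Matrix.specialUnitaryGroup (Fin 2) ℂ)) ∧ Measurable Ψ' ∧
              Function.LeftInverse Ψ' Ψ ∧ Function.RightInverse Ψ' Ψ ∧
              ∀ V : GaugeField (F.P K) 0 (Matrix.specialUnitaryGroup (Fin 2) ℂ),
                (∀ k, k < j → PlaqSmall (T3UnitScaleTilt.θBal F.L γ b p₀ (K - k))
                  (Averaging.iter (fun i => BlockAveraging.blockAvg (P := F.P K) (j := i) T3UnitLawDensityEML.ℰp) k V)) →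
                (∀ j', j ≤ j' → j' + n ≤ K → PlaqSmall (T3UnitScaleTilt.θBal F.L γ (Λ * b) p₀ (K - j'))
                  (Averaging.iter (fun i => BlockAveraging.blockAvg (P := F.P K) (j := i) T3UnitLawDensityEML.ℰp) j' V)) →
                (1 - δ ^ 2 / 2) * (T3UnitScaleTilt.θBal F.L γ b p₀ (K - j) *
                    Real.sqrt (1 - T3UnitScaleTilt.θBal F.L γ (Λ * b) p₀ (K - j) ^ 2 / 4)) ≤
                  ⟪v, T4ExpWindowSmallField.imVec (Literature.MathematicalPhysics.QuantumLattice.su2Quat (GaugeField.plaqHol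
                    (Averaging.iter (fun i => BlockAveraging.blockAvg (P := F.P K) (j := i) T3UnitLawDensityEML.ℰp) j V) p))⟫ →
                cg * B10.pFun b₀ p₀ (Real.sqrt (γ * ((F.L : ℝ)⁻¹) ^ (K - j))) ^ 2 - D ≤
                  (F.scheme T3UnitLawDensityEML.ℰp γ).β K * (wilsonAction4 V - wilsonAction4 (Ψ' V))) :
    Summit.QuantumFields.YangMills.Theses.CovariantDischarge.SandwichFractionalWindowTailL :=
  sandwichFractional_of_ranges CovariantDischargeSandwichBoundedDepth.sandwichFractionalWindowTail_boundedDepth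
    (sandwichSweep_of_capped hCap)

/-- **THE SHARED CRUX `UnitScaleTilt.HistoryTailL` (stmt-QuantumFields-19936) FROM THE CAPPED SWEEP STUB AND THE ROUTE'S RESIDUAL, BY NAME** —
the sandwich lane's display: `stub_sandwichSweepGapCapped` (hypothesis `hCap`, registered text VERBATIM) and `SandwichDeepWindowTailL`
(stmt-QuantumFields-24187, organ-class: cut-off-uniform integration at depth Θ(K) = Bałaban's unprinted large-field induction) ⇒ `HistoryTailL`,
through `sandwichFractionalWindowTailL_of_capped` and the landed door ✓`SandwichDischargeDoor.door` (p705200: profile `(max b₁ 1, max p₁ 3)`, ladder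
ratio 2, bare tail + severity-maximal re-cover).  CONDITIONAL on both hypotheses; rung R3 is a record rung, NOT the Clay problem.
[cite: Balaban1985UV3, (7) p.257 and (71) p.273; Balaban1989LargeFieldII, Thm 1 p.358] -/
theorem historyTailL_of_capped_of_deep
    (hCap : ∀ (L : ℕ), ∃ N₁ : ℕ, 0 < N₁ ∧ ∀ (b₀ p₀ Λ : ℝ), 0 < b₀ → 2 < p₀ → 1 < Λ →
      ∃ (j₀ : ℕ) (γ₁ cg D δ : ℝ), 0 < γ₁ ∧ γ₁ ≤ 1 ∧ 0 < cg ∧ 0 < δ ∧ δ ^ 2 ≤ 2 ∧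
        ∀ (F : T3Family) (γ : ℝ), F.L = L → 0 < γ → γ ≤ γ₁ → ∀ (b : ℝ), b₀ ≤ b → ∀ (K n j : ℕ), j₀ < j → N₁ * j + n ≤ K →
          b ≤ 2 * (151 * (F.L : ℝ) ^ 2) ^ j * b₀ → T3UnitScaleTilt.θBal F.L γ (Λ * b) p₀ (K - j) ≤ 1 →
          ∀ (p : Plaq (F.P K) j) (v : EuclideanSpace ℝ (Fin 3)), ‖v‖ = 1 →
            ∃ (Ψ Ψ' : GaugeField (F.P K) 0 (Matrix.specialUnitaryGroup (Fin 2) ℂ) → GaugeField (F.P K) 0 (Matrix.specialUnitaryGroup (Fin 2) ℂ)),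
              MeasurePreserving Ψ (fieldMeasure (F.P K) 0 (Matrix.specialUnitaryGroup (Fin 2) ℂ)) (fieldMeasure (F.P K) 0 (Matrix.specialUnitaryGroup (Fin 2) ℂ)) ∧ Measurable Ψ' ∧
              Function.LeftInverse Ψ' Ψ ∧ Function.RightInverse Ψ' Ψ ∧
              ∀ V : GaugeField (F.P K) 0 (Matrix.specialUnitaryGroup (Fin 2) ℂ),
                (∀ k, k < j → PlaqSmall (T3UnitScaleTilt.θBal F.L γ b p₀ (K - k))
                  (Averaging.iter (fun i => BlockAveraging.blockAvg (P := F.P K) (j := i) T3UnitLawDensityEML.ℰp) k V)) →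
                (∀ j', j ≤ j' → j' + n ≤ K → PlaqSmall (T3UnitScaleTilt.θBal F.L γ (Λ * b) p₀ (K - j'))
                  (Averaging.iter (fun i => BlockAveraging.blockAvg (P := F.P K) (j := i) T3UnitLawDensityEML.ℰp) j' V)) →
                (1 - δ ^ 2 / 2) * (T3UnitScaleTilt.θBal F.L γ b p₀ (K - j) *
                    Real.sqrt (1 - T3UnitScaleTilt.θBal F.L γ (Λ * b) p₀ (K - j) ^ 2 / 4)) ≤
                  ⟪v, T4ExpWindowSmallField.imVec (Literature.MathematicalPhysics.QuantumLattice.su2Quat (GaugeField.plaqHol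
                    (Averaging.iter (fun i => BlockAveraging.blockAvg (P := F.P K) (j := i) T3UnitLawDensityEML.ℰp) j V) p))⟫ →
                cg * B10.pFun b₀ p₀ (Real.sqrt (γ * ((F.L : ℝ)⁻¹) ^ (K - j))) ^ 2 - D ≤
                  (F.scheme T3UnitLawDensityEML.ℰp γ).β K * (wilsonAction4 V - wilsonAction4 (Ψ' V)))
    (hDeep : Summit.QuantumFields.YangMills.Theses.CovariantDischarge.SandwichDeepWindowTailL) :
    Summit.QuantumFields.YangMills.Theses.UnitScaleTilt.HistoryTailL :=
  SandwichDischargeDoor.door (sandwichFractionalWindowTailL_of_capped hCap) hDeep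

end CovariantDischargeSandwichFractionalOfCapped

end Summit.QuantumFields.YangMills.Theorems

end
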